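import Literature.Topology.FourManifolds.SurfaceGroupHomology
import Literature.Topology.FourManifolds.SurfaceGroupGenusOne
import Mathlib.LinearAlgebra.Matrix.Notation
import Mathlib.Algebra.BigOperators.Fin
import HarnessLib

/-!
# Characters of the surface group pulled back from a free group are isotropic for the
# intersection form

Topic `Literature/Topology/FourManifolds`; theorems only, over `SurfaceGroupHomology.lean`
(`symplForm` = the intersection form `ν` on `surfaceGen g → ℤ`, ZVC 3.6.5) and
`GroupTrisections.lean` / `SurfaceGroupGenusOne.lean` (`SurfaceGroup`, `surfaceRelator`,
`SurfaceGroup.mk_surfaceRelator`).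

* `symplForm_comp_freeGroupHom_eq_zero` — for a homomorphism `φ : S_g → F` to a free group and
  characters `ξ, η : F → ℤ`, the vectors `(ξφ(x))_x`, `(ηφ(x))_x ∈ ℤ^{2g}` of values on the
  generators satisfy `ν(ξφ, ηφ) = ∑ᵢ (ξφ(aᵢ)ηφ(bᵢ) - ξφ(bᵢ)ηφ(aᵢ)) = 0`.  Topologically this is
  the vanishing of the cup product `ξ ∪ η ∈ H²(Σ_g) = ℤ` of classes pulled back from the
  aspherical `K(F,1)` (a graph, `H² = 0`), i.e. the statement that the kernel of
  `H₁(Σ_g) → H₁(H)` of a handlebody `H` is Lagrangian (e.g. the Lagrangian subspaces of a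
  Heegaard splitting / trisection diagram).  The proof here is purely algebraic: represent `F`
  in the integer Heisenberg group (unitriangular `3 × 3` matrices) by `y ↦ (ξ y, η y, 0)`; the
  commutator identity `[(a,b,*), (a',b',*)] = (0, 0, ab' - a'b)` evaluates the relator
  `∏[aᵢ,bᵢ]`, which dies in `F`, to `(0, 0, ν(ξφ, ηφ))`.
* `unitriangular_mul`, `unitriangular_mul_inv`, `unitriangular_inv_mul`,
  `unitriangular_apply_zero_two` — the Heisenberg group law on `!![1,a,c; 0,1,b; 0,0,1]`.

## References

* H. Zieschang, E. Vogt, H.-D. Coldewey, *Surfaces and Planar Discontinuous Groups*, LNM 835,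
  Springer (1980), 3.6.3–3.6.5 (intersection form on `H₁`). [ZieschangVogtColdewey1980]
* A. Hatcher, *Algebraic Topology*, CUP (2002), §3.2 Example 3.7 (cup product of `Σ_g`).
  [HatcherAT2002]
-/

noncomputable section

namespace Literature.Topology.FourManifolds

open Multiplicative

/-- Products of integer unitriangular `3 × 3` matrices (the Heisenberg group law
`(a,b,c)·(a',b',c') = (a+a', b+b', c+c'+ab')`). [folklore] -/
theorem unitriangular_mul (a b c a' b' c' : ℤ) :
    (!![1, a, c; 0, 1, b; 0, 0, 1] : Matrix (Fin 3) (Fin 3) ℤ) * !![1, a', c'; 0, 1, b'; 0, 0, 1] =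
      !![1, a + a', c + c' + a * b'; 0, 1, b + b'; 0, 0, 1] := by
  rw [Matrix.mul_fin_three]
  congr 1
  funext i j
  fin_cases i <;> fin_cases j <;> simp <;> ring


/-- The `(0,2)` entry of a unitriangular matrix. [folklore] -/
theorem unitriangular_apply_zero_two (a b c : ℤ) :
    (!![1, a, c; 0, 1, b; 0, 0, 1] : Matrix (Fin 3) (Fin 3) ℤ) 0 2 = c := rfl

/-- Right inverse of a unitriangular matrix. [folklore] -/
theorem unitriangular_mul_inv (a b c : ℤ) :
    (!![1, a, c; 0, 1, b; 0, 0, 1] : Matrix (Fin 3) (Fin 3) ℤ) * !![1, -a, a * b - c; 0, 1, -b; 0, 0, 1] = 1 := by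
  rw [unitriangular_mul, Matrix.one_fin_three]
  congr 1
  funext i j
  fin_cases i <;> fin_cases j <;> simp

/-- Left inverse of a unitriangular matrix. [folklore] -/
theorem unitriangular_inv_mul (a b c : ℤ) :
    (!![1, -a, a * b - c; 0, 1, -b; 0, 0, 1] : Matrix (Fin 3) (Fin 3) ℤ) * !![1, a, c; 0, 1, b; 0, 0, 1] = 1 := by
  rw [unitriangular_mul, Matrix.one_fin_three]
  congr 1
  funext i j
  fin_cases i <;> fin_cases j <;> simp

/-- **Cup products of classes pulled back from a free group vanish.**  Let `φ : S_g → F` be a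
homomorphism of the surface group `S_g = ⟨a₁,b₁,…,a_g,b_g ∣ ∏[aᵢ,bᵢ]⟩` to a free group and let
`ξ, η : F → ℤ` be characters.  Then the characters `ξ ∘ φ`, `η ∘ φ` of `S_g`, read as vectors of
`H¹(Σ_g; ℤ) = ℤ^{2g}` (values on the generators), are orthogonal for the intersection form:
`∑ᵢ (ξφ(aᵢ) ηφ(bᵢ) - ξφ(bᵢ) ηφ(aᵢ)) = 0`.  (Topologically: `ξ ∪ η` is pulled back from
`H²(F) = 0`.)  Algebraic proof: map `F` to the integer Heisenberg group by
`y ↦ (ξ y, η y, 0)`; the commutator `[(a,b,*), (a',b',*)] = (0, 0, ab' - a'b)` shows that the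
relator `∏[aᵢ,bᵢ]`, which dies in `F`, is sent to `(0, 0, ∑ᵢ (ξφ(aᵢ)ηφ(bᵢ) - ξφ(bᵢ)ηφ(aᵢ)))`.
[folklore] -/
theorem symplForm_comp_freeGroupHom_eq_zero {g : ℕ} {β : Type*} (φ : SurfaceGroup g →* FreeGroup β)
    (ξ η : FreeGroup β →* Multiplicative ℤ) :
    symplForm (fun x : surfaceGen g => toAdd (ξ (φ (PresentedGroup.of x))))
      (fun x => toAdd (η (φ (PresentedGroup.of x)))) = 0 := by
  -- the Heisenberg group inside `GL₃(ℤ)`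
  let u : ℤ → ℤ → ℤ → (Matrix (Fin 3) (Fin 3) ℤ)ˣ := fun a b c =>
    ⟨!![1, a, c; 0, 1, b; 0, 0, 1], !![1, -a, a * b - c; 0, 1, -b; 0, 0, 1],
      unitriangular_mul_inv a b c, unitriangular_inv_mul a b c⟩
  have hu_val : ∀ a b c, (u a b c : Matrix (Fin 3) (Fin 3) ℤ) = !![1, a, c; 0, 1, b; 0, 0, 1] :=
    fun a b c => rfl
  have hu_congr : ∀ {a b c a' b' c' : ℤ}, a = a' → b = b' → c = c' → u a b c = u a' b' c' := by
    rintro a b c _ _ _ rfl rfl rfl; rfl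
  have hu_mul : ∀ a b c a' b' c', u a b c * u a' b' c' = u (a + a') (b + b') (c + c' + a * b') := by
    intro a b c a' b' c'
    ext1
    rw [Units.val_mul, hu_val, hu_val, hu_val, unitriangular_mul]
  have hu_one : u 0 0 0 = 1 := by
    ext1
    rw [hu_val, Units.val_one, Matrix.one_fin_three]
  have hu_inv : ∀ a b c, (u a b c)⁻¹ = u (-a) (-b) (a * b - c) := by
    intro a b c
    rw [inv_eq_iff_mul_eq_one, hu_mul, ← hu_one]
    exact hu_congr (by ring) (by ring) (by ring)
  have hu_comm : ∀ a b c a' b' c',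
      u a b c * u a' b' c' * (u a b c)⁻¹ * (u a' b' c')⁻¹ = u 0 0 (a * b' - a' * b) := by
    intro a b c a' b' c'
    rw [hu_inv, hu_inv, hu_mul, hu_mul, hu_mul]
    exact hu_congr (by ring) (by ring) (by ring)
  have hu_entry : ∀ c, ((u 0 0 c : (Matrix (Fin 3) (Fin 3) ℤ)ˣ) : Matrix (Fin 3) (Fin 3) ℤ) 0 2 = c :=
    fun c => by rw [hu_val, unitriangular_apply_zero_two]
  -- the Heisenberg representation of the free group `F_β`
  let h₁ : FreeGroup β →* (Matrix (Fin 3) (Fin 3) ℤ)ˣ :=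
    FreeGroup.lift fun y => u (toAdd (ξ (FreeGroup.of y))) (toAdd (η (FreeGroup.of y))) 0
  have hinv : ∀ w, ∃ c, h₁ w = u (toAdd (ξ w)) (toAdd (η w)) c := by
    intro w
    induction w using FreeGroup.induction_on with
    | C1 =>
      refine ⟨0, ?_⟩
      rw [map_one h₁, ← hu_one]
      exact hu_congr (by rw [map_one ξ, toAdd_one]) (by rw [map_one η, toAdd_one]) rfl
    | of y => exact ⟨0, by simp only [h₁, FreeGroup.lift_apply_of]⟩
    | inv_of y _ =>
      refine ⟨toAdd (ξ (FreeGroup.of y)) * toAdd (η (FreeGroup.of y)), ?_⟩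
      rw [map_inv h₁]
      simp only [h₁, FreeGroup.lift_apply_of]
      rw [hu_inv]
      exact hu_congr (by rw [map_inv ξ, toAdd_inv]) (by rw [map_inv η, toAdd_inv]) (by ring)
    | mul x y ihx ihy =>
      obtain ⟨c, hc⟩ := ihx
      obtain ⟨c', hc'⟩ := ihy
      refine ⟨c + c' + toAdd (ξ x) * toAdd (η y), ?_⟩
      rw [map_mul h₁, hc, hc', hu_mul]
      exact hu_congr (by rw [map_mul ξ, toAdd_mul]) (by rw [map_mul η, toAdd_mul]) rfl
  -- pull back to the free group on the surface generators
  let ψ : FreeGroup (surfaceGen g) →* FreeGroup β := FreeGroup.lift fun x => φ (PresentedGroup.of x)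
  have hψ : ψ = φ.comp (PresentedGroup.mk _) := FreeGroup.ext_hom _ _ fun x => by
    simp only [ψ, FreeGroup.lift_apply_of, MonoidHom.comp_apply]
    rfl
  have hψr : ψ (surfaceRelator g) = 1 := by
    rw [hψ, MonoidHom.comp_apply, SurfaceGroup.mk_surfaceRelator, map_one φ]
  set h₂ : FreeGroup (surfaceGen g) →* (Matrix (Fin 3) (Fin 3) ℤ)ˣ := h₁.comp ψ with hh₂
  -- abbreviations for the two characters on generators
  set ξ' : surfaceGen g → ℤ := fun x => toAdd (ξ (φ (PresentedGroup.of x))) with hξ'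
  set η' : surfaceGen g → ℤ := fun x => toAdd (η (φ (PresentedGroup.of x))) with hη'
  have hgen : ∀ x : surfaceGen g, ∃ c, h₂ (FreeGroup.of x) = u (ξ' x) (η' x) c := by
    intro x
    obtain ⟨c, hc⟩ := hinv (φ (PresentedGroup.of x))
    refine ⟨c, ?_⟩
    rw [hh₂, MonoidHom.comp_apply]
    simp only [ψ, FreeGroup.lift_apply_of]
    exact hc
  -- each commutator `[aᵢ, bᵢ]` goes to the central element `(0, 0, ξ'(aᵢ)η'(bᵢ) - ξ'(bᵢ)η'(aᵢ))`
  have hcomm : ∀ i : Fin g, h₂ (genA i * genB i * (genA i)⁻¹ * (genB i)⁻¹) =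
      u 0 0 (ξ' (i, false) * η' (i, true) - ξ' (i, true) * η' (i, false)) := by
    intro i
    obtain ⟨c, hc⟩ := hgen (i, false)
    obtain ⟨c', hc'⟩ := hgen (i, true)
    rw [map_mul h₂, map_mul h₂, map_mul h₂, map_inv h₂, map_inv h₂, genA, genB, hc, hc', hu_comm]
  have hprod : ∀ l : List (Fin g),
      (l.map fun i => h₂ (genA i * genB i * (genA i)⁻¹ * (genB i)⁻¹)).prod =
        u 0 0 (l.map fun i => ξ' (i, false) * η' (i, true) - ξ' (i, true) * η' (i, false)).sum := by
    intro l
    induction l with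
    | nil => rw [List.map_nil, List.map_nil, List.prod_nil, List.sum_nil, hu_one]
    | cons i l ih =>
      rw [List.map_cons, List.map_cons, List.prod_cons, List.sum_cons, ih, hcomm, hu_mul]
      exact hu_congr (by ring) (by ring) (by ring)
  -- the relator dies, so the sum vanishes
  have hr : h₂ (surfaceRelator g) = 1 := by rw [hh₂, MonoidHom.comp_apply, hψr, map_one h₁]
  have hr' : h₂ (surfaceRelator g) =
      u 0 0 (∑ i : Fin g, (ξ' (i, false) * η' (i, true) - ξ' (i, true) * η' (i, false))) := by
    unfold surfaceRelator
    rw [map_list_prod, List.map_map]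
    rw [show ((fun i => h₂ (genA i * genB i * (genA i)⁻¹ * (genB i)⁻¹)) : Fin g → _) =
      (⇑h₂ ∘ fun i => genA i * genB i * (genA i)⁻¹ * (genB i)⁻¹) from rfl] at hprod
    rw [hprod, Fin.sum_univ_def]
  have key := congrArg (fun M : (Matrix (Fin 3) (Fin 3) ℤ)ˣ => (M : Matrix (Fin 3) (Fin 3) ℤ) 0 2)
    (hr'.symm.trans hr)
  simp only [hu_entry, Units.val_one, Matrix.one_apply_ne (by decide : (0 : Fin 3) ≠ 2)] at key
  rw [symplForm_apply]
  exact key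

/-- Corollary: integer combinations of characters pulled back from the free group are still
mutually isotropic (bilinearity), e.g. `ν(ξφ + ξ'φ, ηφ) = 0`. [folklore] -/
theorem symplForm_comp_freeGroupHom_add_eq_zero {g : ℕ} {β : Type*}
    (φ : SurfaceGroup g →* FreeGroup β) (ξ ξ' η : FreeGroup β →* Multiplicative ℤ) :
    symplForm ((fun x : surfaceGen g => toAdd (ξ (φ (PresentedGroup.of x)))) +
        fun x => toAdd (ξ' (φ (PresentedGroup.of x))))
      (fun x => toAdd (η (φ (PresentedGroup.of x)))) = 0 := by
  rw [map_add, LinearMap.add_apply, symplForm_comp_freeGroupHom_eq_zero,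
    symplForm_comp_freeGroupHom_eq_zero, add_zero]

end Literature.Topology.FourManifolds

end
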